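import Summits.QuantumAdvantage.QuantumAdvantage.Theorems.CubicStability.Negative.WithoutEven
import Literature.Computability.QuantumComplexity.ForrelationDerivativeTables

/-!
# `CubicStability` (stmt-QuantumAdvantage-2202), negative side — the `P₄` witness (blocks, three-bit facts, cubicity)

Support file 1/2 for the refutation of
`Summit.QuantumAdvantage.QuantumAdvantage.Theses.CubicForrelation.CubicStability`
(`Theorems/CubicForrelationCubicStabilityRefutation.lean`). The decomposition `𝔽₂¹² = (𝔽₂³)⁴`
(twist and Walsh transforms factorise over the blocks), the three-bit facts about `[wt = 2]` and the
cube `v₀v₁v₂` (`W_{c₃} = 8[v=0] - 2(-1)^{wt v}`, sign pattern `(-1)^{[wt=2]}`, block weight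
`m ∈ {6,2}`), the witness pair `a(u) = ∑_k [wt(u^k) = 2]`, `b(u) = ∑_k u^k₀u^k₁u^k₂` with its
`MvPolynomial` cubicity witnesses, the probe vectors `1¹²`, `e(k,w)`, and the bookkeeping functions
`P` (sign pattern), `z` (number of zero blocks), `t = z[z odd]`. Everything is a theorem or an explicit
definition; no named facts. (refuter-cruxtri-stmt-QuantumAdvantage-2202-r1-3-0, 2026-08-16.)
-/

noncomputable section

open Finset
open Literature.Computability.QuantumComplexity
open Literature.Computability.QuantumComplexity.DerivativeWalsh (W)
open Literature.Computability.QuantumComplexity.BuzetChailloux (zeroVec sum_twist_left)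
open Literature.Computability.QuantumComplexity.Simon (sum_twist)

namespace Summit.QuantumAdvantage.QuantumAdvantage.Theorems.CubicStability.Negative.P4

/-- `signOf (a ⊕ b) = signOf a · signOf b`. [folklore] -/
theorem signOf_xor (a b : Bool) : signOf (a ^^ b) = signOf a * signOf b := by
  cases a <;> cases b <;> norm_num [signOf]

/-! ### Four blocks of three bits -/

/-- A block of three bits. -/
abbrev V := Fin 3 → Bool

/-- The index of bit `j` of block `k`. -/
def ix (k : Fin 4) (j : Fin 3) : Fin (4 * 3) := finProdFinEquiv (k, j)

/-- Block `k` of a 12-bit vector. -/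
def blk (u : Fin (4 * 3) → Bool) (k : Fin 4) : V := fun j => u (ix k j)

/-- 12-bit vectors as 4-tuples of blocks. [folklore] -/
def eBlk : (Fin (4 * 3) → Bool) ≃ (Fin 4 → V) :=
  ((Equiv.arrowCongr finProdFinEquiv (Equiv.refl Bool)).symm).trans (Equiv.curry _ _ _)

/-- `eBlk` lists the blocks. [folklore] -/
@[simp] theorem eBlk_apply (u : Fin (4 * 3) → Bool) : eBlk u = blk u := rfl

/-- The blocks of the vector assembled from `U` are `U`. [folklore] -/
theorem blk_eBlk_symm (U : Fin 4 → V) : blk (eBlk.symm U) = U := by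
  rw [← eBlk_apply, Equiv.apply_symm_apply]

/-- The twist factorises over the blocks. [folklore] -/
theorem twist_blocks (u v : Fin (4 * 3) → Bool) : twist u v = ∏ k, twist (blk u k) (blk v k) := by
  unfold twist
  rw [← Fintype.prod_equiv finProdFinEquiv
      (fun p : Fin 4 × Fin 3 => if u (finProdFinEquiv p) && v (finProdFinEquiv p) then (-1 : ℝ) else 1)
      _ (fun _ => rfl), Fintype.prod_prod_type]
  rfl

/-- Tensor sums: `∑_u ∏_k F_k(u^k) = ∏_k ∑_v F_k(v)`. [folklore] -/
theorem sum_prod_blocks (F : Fin 4 → V → ℝ) :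
    ∑ u : Fin (4 * 3) → Bool, ∏ k, F k (blk u k) = ∏ k, ∑ v : V, F k v := by
  rw [Fintype.prod_sum]
  rw [← eBlk.symm.sum_comp]
  refine sum_congr rfl fun U _ => ?_
  rw [blk_eBlk_symm]

/-- Walsh transform of a block-product function is the product of the block transforms. [folklore] -/
theorem W_blocks (h : Fin 4 → V → ℝ) (x : Fin (4 * 3) → Bool) :
    W (fun u => ∏ k, h k (blk u k)) x = ∏ k, W (h k) (blk x k) := by
  rw [show W (fun u => ∏ k, h k (blk u k)) x = ∑ u, (∏ k, h k (blk u k)) * twist u x from rfl]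
  simp_rw [twist_blocks, ← prod_mul_distrib]
  have key := sum_prod_blocks (fun k v => h k v * twist v (blk x k))
  rw [key]
  rfl

/-! ### Three-bit facts -/

/-- The zero block. -/
def zero3 : V := fun _ => false

/-- The all-ones block. -/
def ones3 : V := fun _ => true

/-- `[wt(a,b,c) = 2]`. -/
def s3b (a b c : Bool) : Bool := (a && b && !c) || (a && !b && c) || (!a && b && c)

/-- `[wt(v) = 2]` on a block. -/
def s3 (v : V) : Bool := s3b (v 0) (v 1) (v 2)

/-- The cube `v₀ v₁ v₂` on a block. -/
def c3 (v : V) : Bool := v 0 && v 1 && v 2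

/-- Blocks as triples of bits. [folklore] -/
def eV : V ≃ Bool × Bool × Bool where
  toFun v := (v 0, v 1, v 2)
  invFun p := ![p.1, p.2.1, p.2.2]
  left_inv v := by
    funext j
    fin_cases j <;> rfl
  right_inv p := by
    obtain ⟨a, b, c⟩ := p
    rfl

/-- A sum over a block is a triple Boolean sum. [folklore] -/
theorem sum_V (F : V → ℝ) : ∑ v, F v = ∑ a : Bool, ∑ b : Bool, ∑ c : Bool, F ![a, b, c] := by
  rw [← eV.symm.sum_comp, Fintype.sum_prod_type]
  refine sum_congr rfl fun a _ => ?_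
  rw [Fintype.sum_prod_type]
  rfl

/-- A statement about all blocks is a statement about all triples of bits. [folklore] -/
theorem forall_V {P : V → Prop} : (∀ v, P v) ↔ ∀ a b c : Bool, P ![a, b, c] := by
  constructor
  · intro h a b c; exact h _
  · intro h v
    have := h (v 0) (v 1) (v 2)
    have hv : (![v 0, v 1, v 2] : V) = v := eV.left_inv v
    rwa [hv] at this

/-- Equality of a literal triple with a block, componentwise. [folklore] -/
theorem vec3_eq_iff (a b c : Bool) (w : V) : ((![a, b, c] : V) = w) ↔ (a = w 0 ∧ b = w 1 ∧ c = w 2) := by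
  constructor
  · rintro rfl; exact ⟨rfl, rfl, rfl⟩
  · rintro ⟨h0, h1, h2⟩
    funext j
    fin_cases j
    · exact h0
    · exact h1
    · exact h2

/-- The twist on a block, expanded. [folklore] -/
theorem twist_V (v w : V) : twist v w =
    (if v 0 && w 0 then -1 else 1) * (if v 1 && w 1 then -1 else 1) * (if v 2 && w 2 then -1 else 1) := by
  unfold twist
  rw [Fin.prod_univ_three]

/-- `ε(v) := (-1)^{[wt v = 2]} (-1)^{wt v}` equals `+1` at `v = 0` and `-1` otherwise. [folklore] -/
def eps (v : V) : ℝ := if v = zero3 then 1 else -1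

/-- `(-1)^{[wt v = 2]} (-1)^{wt v} = ε(v)`: `+1` at `v = 0`, `-1` otherwise. [folklore] -/
theorem eps_eq (v : V) : signOf (s3 v) * twist v ones3 = eps v := by
  revert v
  rw [forall_V]
  intro a b c
  unfold eps
  rw [twist_V]
  simp only [s3, s3b, ones3, zero3, Matrix.cons_val_zero, Matrix.cons_val_one, Matrix.head_cons,
    Matrix.cons_val_two, Matrix.tail_cons, Bool.and_true, vec3_eq_iff]
  cases a <;> cases b <;> cases c <;> norm_num [signOf]

/-- A block has 8 values. [folklore] -/
theorem card_V : Fintype.card V = 8 := by simp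

/-- `∑_v (if v = 0 then A else B) = A + 7B` on a block. [folklore] -/
theorem sum_ite_zero3 (A B : ℝ) : ∑ v : V, (if v = zero3 then A else B) = A + 7 * B := by
  have e : (fun v : V => if v = zero3 then A else B) = fun v => B + (if v = zero3 then A - B else 0) := by
    funext v; split_ifs <;> ring
  rw [e, sum_add_distrib, sum_ite_eq' univ, if_pos (mem_univ _)]
  simp only [sum_const, card_univ, card_V, nsmul_eq_mul]
  push_cast; ring

/-- `∑_v ε(v) = -6`. [folklore] -/
theorem sum_eps : ∑ v : V, eps v = -6 := by
  unfold eps; rw [sum_ite_zero3]; norm_num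

/-- `(-1)^{0·w} = 1`. [folklore] -/
theorem twist_zero3_left (w : V) : twist zero3 w = 1 := by
  unfold twist zero3; simp

/-- `(-1)^{w·0} = 1`. [folklore] -/
theorem twist_zero3_right (w : V) : twist w zero3 = 1 := by
  rw [twist_comm]; exact twist_zero3_left w

/-- `∑_v ε(v) (-1)^{v·w} = 2` for `w ≠ 0`. [folklore] -/
theorem sum_eps_twist (w : V) (hw : w ≠ zero3) : ∑ v : V, eps v * twist v w = 2 := by
  have e : ∀ v : V, eps v * twist v w = -twist v w + (if v = zero3 then 2 * twist v w else 0) := by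
    intro v; unfold eps; split_ifs <;> ring
  simp_rw [e]
  rw [sum_add_distrib, sum_ite_eq' univ, if_pos (mem_univ _), sum_neg_distrib, twist_zero3_left]
  have hs := sum_twist_left (n := 3) w
  rw [if_neg (show w ≠ zeroVec from hw)] at hs
  rw [hs]; norm_num

/-- `∑_{w ≠ 0} (-1)^{v·w} = 8[v = 0] - 1`. [folklore] -/
theorem sum_twist_erase (v : V) :
    ∑ w ∈ univ.erase zero3, twist v w = (if v = zero3 then 8 else 0) - 1 := by
  rw [sum_erase_eq_sub (mem_univ _), twist_zero3_right, sum_twist,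
    show ((fun _ => false) : V) = zero3 from rfl]
  norm_num

/-- The Walsh transform of the signed cube on a block: `8[v = 0] - 2 (-1)^{wt v}`. [folklore] -/
theorem W_c3 (v : V) : W (fun y => signOf (c3 y)) v = (if v = zero3 then 8 else 0) - 2 * twist ones3 v := by
  have e : ∀ y : V, signOf (c3 y) = 1 + (if y = ones3 then -2 else 0) := by
    rw [forall_V]
    intro a b c
    simp only [c3, ones3, Matrix.cons_val_zero, Matrix.cons_val_one, Matrix.head_cons,
      Matrix.cons_val_two, Matrix.tail_cons, vec3_eq_iff]
    cases a <;> cases b <;> cases c <;> norm_num [signOf]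
  rw [show W (fun y => signOf (c3 y)) v = ∑ y, signOf (c3 y) * twist y v from rfl]
  simp_rw [e, add_mul, one_mul, sum_add_distrib, ite_mul, zero_mul, sum_ite_eq' univ, if_pos (mem_univ _)]
  rw [sum_twist_left]
  have : (zeroVec : V) = zero3 := rfl
  rw [this]
  norm_num
  ring

/-- The block weight `m(v) = (-1)^{[wt v = 2]} W_{c₃}(v) ∈ {6, 2}`. [folklore] -/
def mV (v : V) : ℝ := if v = zero3 then 6 else 2

/-- `(-1)^{[wt v = 2]} W_{c₃}(v) = m(v)`. [folklore] -/
theorem mV_eq (v : V) : signOf (s3 v) * W (fun y => signOf (c3 y)) v = mV v := by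
  rw [W_c3]
  unfold mV
  by_cases hv : v = zero3
  · subst hv
    simp [s3, s3b, zero3, signOf, twist_zero3_right]
    norm_num
  · rw [if_neg hv, if_neg hv]
    have h := eps_eq v
    unfold eps at h
    rw [if_neg hv, twist_comm] at h
    linear_combination (-2) * h

/-- `∑_v m(v) = 6 + 7·2 = 20`. [folklore] -/
theorem sum_mV : ∑ v : V, mV v = 20 := by
  unfold mV; rw [sum_ite_zero3]; norm_num

/-! ### The witness pair on 12 bits -/

/-- `a(u) = ∑_k [wt(u^k) = 2]` (mod 2). -/
def fA (u : Fin (4 * 3) → Bool) : Bool := s3 (blk u 0) ^^ s3 (blk u 1) ^^ s3 (blk u 2) ^^ s3 (blk u 3)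

/-- `b(u) = ∑_k u^k₀ u^k₁ u^k₂` (mod 2). -/
def gB (u : Fin (4 * 3) → Bool) : Bool := c3 (blk u 0) ^^ c3 (blk u 1) ^^ c3 (blk u 2) ^^ c3 (blk u 3)

/-- `(-1)^{a(u)} = ∏_k (-1)^{[wt u^k = 2]}`. [folklore] -/
theorem sf_eq (u : Fin (4 * 3) → Bool) : signOf (fA u) = ∏ k, signOf (s3 (blk u k)) := by
  rw [Fin.prod_univ_four]; unfold fA; rw [signOf_xor, signOf_xor, signOf_xor]

/-- `(-1)^{b(u)} = ∏_k (-1)^{u^k₀u^k₁u^k₂}`. [folklore] -/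
theorem sg_eq (u : Fin (4 * 3) → Bool) : signOf (gB u) = ∏ k, signOf (c3 (blk u k)) := by
  rw [Fin.prod_univ_four]; unfold gB; rw [signOf_xor, signOf_xor, signOf_xor]

/-! #### Cubicity witnesses -/

section Cubic

open MvPolynomial

/-- The cubic polynomial of block `k` for `a`: `X₀X₁ + X₀X₂ + X₁X₂ + X₀X₁X₂`. -/
def qS (k : Fin 4) : MvPolynomial (Fin (4 * 3)) (ZMod 2) :=
  X (ix k 0) * X (ix k 1) + X (ix k 0) * X (ix k 2) + X (ix k 1) * X (ix k 2) +
    X (ix k 0) * X (ix k 1) * X (ix k 2)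

/-- The cube of block `k`. -/
def qC (k : Fin 4) : MvPolynomial (Fin (4 * 3)) (ZMod 2) := X (ix k 0) * X (ix k 1) * X (ix k 2)

/-- `deg (XᵢXⱼ) ≤ 2`. [folklore] -/
theorem deg_X2 (i j : Fin (4 * 3)) : (X i * X j : MvPolynomial (Fin (4 * 3)) (ZMod 2)).totalDegree ≤ 2 :=
  (totalDegree_mul _ _).trans (by rw [totalDegree_X, totalDegree_X])

/-- `deg (XᵢXⱼXₗ) ≤ 3`. [folklore] -/
theorem deg_X3 (i j l : Fin (4 * 3)) :
    (X i * X j * X l : MvPolynomial (Fin (4 * 3)) (ZMod 2)).totalDegree ≤ 3 :=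
  (totalDegree_mul _ _).trans (by
    have := deg_X2 i j
    rw [totalDegree_X]; omega)

/-- The block polynomial of `a` has total degree `≤ 3`. [folklore] -/
theorem deg_qS (k : Fin 4) : (qS k).totalDegree ≤ 3 := by
  unfold qS
  refine (totalDegree_add _ _).trans (max_le ?_ (deg_X3 _ _ _))
  refine (totalDegree_add _ _).trans (max_le ?_ ((deg_X2 _ _).trans (by norm_num)))
  exact (totalDegree_add _ _).trans (max_le ((deg_X2 _ _).trans (by norm_num)) ((deg_X2 _ _).trans (by norm_num)))

/-- The block cube has total degree `≤ 3`. [folklore] -/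
theorem deg_qC (k : Fin 4) : (qC k).totalDegree ≤ 3 := deg_X3 _ _ _

/-- A sum of four polynomials of degree `≤ 3` has degree `≤ 3`. [folklore] -/
theorem deg_sum4 (q : Fin 4 → MvPolynomial (Fin (4 * 3)) (ZMod 2)) (hq : ∀ k, (q k).totalDegree ≤ 3) :
    (q 0 + q 1 + q 2 + q 3).totalDegree ≤ 3 :=
  (totalDegree_add _ _).trans (max_le ((totalDegree_add _ _).trans (max_le
    ((totalDegree_add _ _).trans (max_le (hq 0) (hq 1))) (hq 2))) (hq 3))

/-- `ab + ac + bc + abc = [wt(a,b,c) = 2]` in `𝔽₂`. [folklore] -/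
theorem s3b_zmod (a b c : Bool) :
    ((if a then 1 else 0) * (if b then 1 else 0) + (if a then 1 else 0) * (if c then 1 else 0) +
      (if b then 1 else 0) * (if c then 1 else 0) +
      (if a then 1 else 0) * (if b then 1 else 0) * (if c then 1 else 0) : ZMod 2) =
      if s3b a b c then 1 else 0 := by
  cases a <;> cases b <;> cases c <;> decide

/-- `abc = [a ∧ b ∧ c]` in `𝔽₂`. [folklore] -/
theorem c3_zmod (a b c : Bool) :
    ((if a then 1 else 0) * (if b then 1 else 0) * (if c then 1 else 0) : ZMod 2) =
      if (a && b && c) then 1 else 0 := by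
  cases a <;> cases b <;> cases c <;> decide

/-- A fourfold xor is the parity of the sum of four indicators in `𝔽₂`. [folklore] -/
theorem xor4_zmod (p q r s : Bool) :
    (p ^^ q ^^ r ^^ s) = decide (((if p then 1 else 0) + (if q then 1 else 0) + (if r then 1 else 0) +
      (if s then 1 else 0) : ZMod 2) = 1) := by
  cases p <;> cases q <;> cases r <;> cases s <;> decide

/-- The block polynomial of `a` evaluates to `[wt(x^k) = 2]`. [folklore] -/
theorem eval_qS (x : Fin (4 * 3) → Bool) (k : Fin 4) :
    eval (fun j => if x j then (1 : ZMod 2) else 0) (qS k) = if s3 (blk x k) then 1 else 0 := by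
  simp only [qS, eval_add, eval_mul, eval_X]
  exact s3b_zmod _ _ _

/-- The block cube evaluates to `x^k₀x^k₁x^k₂`. [folklore] -/
theorem eval_qC (x : Fin (4 * 3) → Bool) (k : Fin 4) :
    eval (fun j => if x j then (1 : ZMod 2) else 0) (qC k) = if c3 (blk x k) then 1 else 0 := by
  simp only [qC, eval_mul, eval_X]
  exact c3_zmod _ _ _

/-- `a` is cubic (witness `∑_k qS k`). [folklore] -/
theorem isCubic_fA : CubicStability.Negative.IsCubic fA := by
  refine ⟨qS 0 + qS 1 + qS 2 + qS 3, deg_sum4 qS deg_qS, fun x => ?_⟩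
  simp only [eval_add, eval_qS]
  exact xor4_zmod _ _ _ _

/-- `b` is cubic (witness `∑_k qC k`). [folklore] -/
theorem isCubic_gB : CubicStability.Negative.IsCubic gB := by
  refine ⟨qC 0 + qC 1 + qC 2 + qC 3, deg_sum4 qC deg_qC, fun x => ?_⟩
  simp only [eval_add, eval_qC]
  exact xor4_zmod _ _ _ _

end Cubic

/-! #### The finite facts about the witness -/

/-- The all-ones vector `x* = 1¹²`. -/
def xstar : Fin (4 * 3) → Bool := fun _ => true

/-- The vector with block `k` equal to `w` and the other blocks zero. -/
def emb (k : Fin 4) (w : V) : Fin (4 * 3) → Bool := eBlk.symm (fun j => if j = k then w else zero3)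

/-- The blocks of `e(k,w)`. [folklore] -/
theorem blk_emb (k : Fin 4) (w : V) (j : Fin 4) : blk (emb k w) j = if j = k then w else zero3 := by
  unfold emb; rw [blk_eBlk_symm]

/-- Every block of `1¹²` is `111`. [folklore] -/
theorem blk_xstar (k : Fin 4) : blk xstar k = ones3 := rfl

/-- `(-1)^{u · e(k,w)} = (-1)^{u^k · w}`. [folklore] -/
theorem twist_emb (u : Fin (4 * 3) → Bool) (k : Fin 4) (w : V) : twist u (emb k w) = twist (blk u k) w := by
  rw [twist_blocks]
  simp_rw [blk_emb]
  have e : ∀ j : Fin 4, twist (blk u j) (if j = k then w else zero3) = if j = k then twist (blk u k) w else 1 := by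
    intro j
    split_ifs with h
    · subst h; rfl
    · exact twist_zero3_right _
  simp_rw [e]
  rw [prod_ite_eq' univ, if_pos (mem_univ _)]


/-- The sign pattern `P(u) = ∏_k ε(u^k) = (-1)^{z(u)}`. -/
def P (u : Fin (4 * 3) → Bool) : ℝ := ∏ k, eps (blk u k)

/-- The number of zero blocks of `u`. -/
def z (u : Fin (4 * 3) → Bool) : ℕ := (univ.filter fun k => blk u k = zero3).card

/-- `t(u) = z(u)` if `z(u)` is odd, `0` otherwise. -/
def t (u : Fin (4 * 3) → Bool) : ℝ := if Odd (z u) then (z u : ℝ) else 0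

/-- `z(u)` as a sum of indicators. [folklore] -/
theorem z_eq_sum (u : Fin (4 * 3) → Bool) : (z u : ℝ) = ∑ k, (if blk u k = zero3 then (1 : ℝ) else 0) := by
  unfold z
  rw [card_filter]
  push_cast
  rfl


end Summit.QuantumAdvantage.QuantumAdvantage.Theorems.CubicStability.Negative.P4
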